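import Mathlib.Analysis.PSeries
import Literature.Probability.LatticeModels.CriticalTwoPointDCPLowerHolds
import Literature.Probability.LatticeModels.RegularScales
import HarnessLib

/-!
# The critical axial two-point function of `ℤ³` is not `o(n^{-3/2})`
# (subsequence form of Duminil-Copin–Panis 2025, Theorem 1.3: "`η ≤ 1/2` along a subsequence")

Topic `Literature/Probability/LatticeModels`; family `crit-ising`. Theorem-only file (no definition, no
named fact), proved from tree theorems.

Duminil-Copin–Panis (CMP 406 (2025), arXiv:2404.05700) print, for `d = 3`: Theorem 1.3 (the axial lower
bound `⟨τ₀τ_{ne₁}⟩_β ≥ c₁/(χ_{4n}(β) + n Σ_{k≤2n} k⟨τ₀τ_{ke₁}⟩_β)`, tree theorem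
`dcp_criticalTwoPoint_axis_lower_holds` at `β = β_c`) and, as its corollary, Theorem 1.5 ("if the
critical exponent `η` exists, it satisfies `η ≤ 1/2`"; tree theorem `dcp_isingEta_le_half_holds`, run on a
POWER ansatz `⟨σ₀σ_x⟩ ≤ K‖x‖^{-(1+b)}`), adding (p. 6) "when `d = 3` we do not obtain a more explicit
pointwise lower bound". This file records the sharpest UNCONDITIONAL pointwise consequence of Theorem 1.3,
which the source does not print but whose proof is the skeleton of its proofs of Theorems 1.5 and 1.8
(`d = 3` branch): the axial profile is not `o(n^{-3/2})`,

  `∃ a > 0, a ≤ n^{3/2} ⟨σ₀σ_{ne₁}⟩_{β_c}` for infinitely many `n`   (`criticalTwoPoint_axis_frequently_ge`),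

i.e. `limsup_n n^{3/2}⟨σ₀σ_{ne₁}⟩_{β_c(3)} > 0` — "`η ≤ 1/2` along a subsequence", with no bubble-diagram
loss and no existence hypothesis. Proof (6 lines on paper): if `m^{3/2}⟨σ₀σ_{me₁}⟩ ≤ a` for all
`m ≥ m₀`, the Messager–Miracle-Solé bound `⟨σ₀σ_x⟩ ≤ ⟨σ₀σ_{‖x‖_∞ e₁}⟩` (tree: `twoPointFree_le_single_of_le`)
and the shell count `|∂Λ_m| ≤ 54m²` give `χ_{4n} ≤ 1 + C·M·√n + 432·a·n^{3/2}` and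
`n Σ_{k≤2n} k⟨σ₀σ_{ke₁}⟩ ≤ M·Z·n + 3·a·n^{3/2}` (`M = m₀^{5/2}`, `Z = Σ_k k^{-3/2}`), so Theorem 1.3 at
`n → ∞` forces `c₁ ≤ o(1) + 435·a²`, impossible for `a < (c₁/435)^{1/2} ∧ a ≤ 1`.

Why it is here: it is the lossless form of the first rung ("(T): `Σ_{L≤|x|<2L}⟨σ₀σ_x⟩² ≥ c` infinitely
often", Aizenman's first-moment criterion) below the open window statements of the `Ising3DConformalLimit`
routes (`…Theses.LatticeSDPCertificates.WindowBelowHalf`, `…Theses.CoerciveSharpness.PhiCoercive`), which ask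
for the STRICT inequality `η_eff < 1/2`; nothing printed gives more than this file in the pointwise direction.

Deliberately NOT here: the shell-sum form `Σ_{L≤|x|<2L}⟨σ₀σ_x⟩² ≥ c` i.o. (one more MMS comparison), the
near-critical range `β < β_c`, and any statement about `limsup |x|^{3/2}⟨σ₀σ_x⟩ = ∞` (open).

## References

* H. Duminil-Copin, R. Panis, *New lower bounds for the (near) critical Ising and φ⁴ models' two-point
  functions*, Comm. Math. Phys. 406 (2025), arXiv:2404.05700, Theorem 1.3 and the proofs of Theorems 1.5,
  1.8 (pp. 5–7 of the arXiv version, held) [DuminilCopinPanis2025LowerBounds].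
* A. Messager, S. Miracle-Solé, J. Stat. Phys. 17 (1977) (monotonicity of correlations; tree file
  `MessagerMiracleSoleFree.lean`) [MessagerMiracleSoleJSP1977].
-/

noncomputable section

open Filter Finset
open _root_.Topology

namespace Literature.Probability.LatticeModels

/-- **Shell bound for the box susceptibility on `ℤ³` by the axial profile** (Messager–Miracle-Solé
`⟨σ₀σ_x⟩^f_β ≤ ⟨σ₀σ_{‖x‖_∞e₁}⟩^f_β` summed over the shells `∂Λ_m`, `|∂Λ_m| = (2m+1)³-(2m-1)³ ≤ 54m²`):
for `β ≥ 0` and every `N`,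
`Σ_{x ∈ Λ_N} ⟨σ₀σ_x⟩^f_β ≤ 1 + Σ_{m=1}^{N} 54 m² ⟨σ₀σ_{me₁}⟩^f_β`.
The counting step "`χ_{4n}`" of the proofs of Duminil-Copin–Panis 2025, Theorems 1.4/1.5/1.8, kept
with a general axial profile instead of a power ansatz. [cite: DuminilCopinPanis2025LowerBounds, proof of Theorem 1.5 (the bound on χ_{4n})] -/
theorem sum_box_three_twoPointFree_le_axis {β : ℝ} (hβ : 0 ≤ β) (N : ℕ) :
    ∑ x ∈ box 3 N, twoPointFree 3 β x ≤
      1 + ∑ m ∈ Finset.Icc 1 N,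
        54 * (m : ℝ) ^ 2 * twoPointFree 3 β (Pi.single (⟨0, by norm_num⟩ : Fin 3) (m : ℤ)) := by
  induction N with
  | zero =>
    have hbox : box 3 0 = {(0 : Site 3)} := by
      ext x
      rw [mem_box_iff_supNorm_le, Nat.le_zero, Site.supNorm_eq_zero_iff, Finset.mem_singleton]
    rw [hbox, Finset.sum_singleton, twoPointFree_zero]
    simp
  | succ N ih =>
    have hsub : box 3 N ⊆ box 3 (N + 1) := box_mono 3 (Nat.le_succ N)
    have hsph : ∑ x ∈ sphere 3 (N + 1), twoPointFree 3 β x ≤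
        54 * ((N + 1 : ℕ) : ℝ) ^ 2 *
          twoPointFree 3 β (Pi.single (⟨0, by norm_num⟩ : Fin 3) ((N + 1 : ℕ) : ℤ)) := by
      have hle : ∀ x ∈ sphere 3 (N + 1), twoPointFree 3 β x ≤
          twoPointFree 3 β (Pi.single (⟨0, by norm_num⟩ : Fin 3) ((N + 1 : ℕ) : ℤ)) :=
        fun x hx => twoPointFree_le_single_of_le hβ (by norm_num) (mem_sphere.1 hx).ge
      have hG0 : 0 ≤ twoPointFree 3 β (Pi.single (⟨0, by norm_num⟩ : Fin 3) ((N + 1 : ℕ) : ℤ)) :=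
        twoPointFree_nonneg_of_nonneg hβ _
      have hcard : (#(sphere 3 (N + 1)) : ℝ) ≤ 54 * ((N + 1 : ℕ) : ℝ) ^ 2 := by
        have h := card_sphere_succ_le (d := 3) N
        norm_num at h
        have hN : (0 : ℝ) ≤ N := Nat.cast_nonneg N
        push_cast
        nlinarith [h, hN, sq_nonneg (N : ℝ)]
      calc ∑ x ∈ sphere 3 (N + 1), twoPointFree 3 β x
          ≤ ∑ _x ∈ sphere 3 (N + 1),
              twoPointFree 3 β (Pi.single (⟨0, by norm_num⟩ : Fin 3) ((N + 1 : ℕ) : ℤ)) :=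
            Finset.sum_le_sum hle
        _ = #(sphere 3 (N + 1)) *
              twoPointFree 3 β (Pi.single (⟨0, by norm_num⟩ : Fin 3) ((N + 1 : ℕ) : ℤ)) := by
            rw [Finset.sum_const, nsmul_eq_mul]
        _ ≤ 54 * ((N + 1 : ℕ) : ℝ) ^ 2 *
              twoPointFree 3 β (Pi.single (⟨0, by norm_num⟩ : Fin 3) ((N + 1 : ℕ) : ℤ)) :=
            mul_le_mul_of_nonneg_right hcard hG0
    rw [← Finset.sum_sdiff hsub, ← sphere_succ_eq_sdiff, Finset.sum_Icc_succ_top (by omega)]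
    linarith [ih, hsph]

/-- `Σ_{k=1}^{N} k^{-1/2} ≤ 2 √N`-type bound in `rpow` form: `Σ_{k ∈ [1,N]} k^{-(1/2)} ≤ 2 N^{1/2}`
(the tree's `sum_Icc_rpow_sub_one_le` with `p = 1/2`); private plumbing. [folklore] -/
private theorem sum_Icc_rpow_neg_half_le (N : ℕ) :
    ∑ k ∈ Finset.Icc 1 N, (k : ℝ) ^ (-(1 / 2 : ℝ)) ≤ 2 * (N : ℝ) ^ (1 / 2 : ℝ) := by
  have h := sum_Icc_rpow_sub_one_le (p := 1 / 2) (by norm_num) (by norm_num) N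
  rw [show (1 / 2 : ℝ) - 1 = -(1 / 2 : ℝ) by norm_num] at h
  calc ∑ k ∈ Finset.Icc 1 N, (k : ℝ) ^ (-(1 / 2 : ℝ)) ≤ (N : ℝ) ^ (1 / 2 : ℝ) / (1 / 2) := h
    _ = 2 * (N : ℝ) ^ (1 / 2 : ℝ) := by ring

/-- **The critical axial two-point function of `ℤ³` is not `o(n^{-3/2})` (free state).** There is
`a > 0` with `a ≤ n^{3/2}·⟨σ₀σ_{ne₁}⟩^f_{β_c}` for infinitely many `n` — the subsequence ("limsup") form
of Duminil-Copin–Panis 2025, Theorem 1.3 on `ℤ³`, i.e. "`η ≤ 1/2` along a subsequence" with no existence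
hypothesis and no bubble loss; the source prints only the conditional Theorem 1.5. Proof: module
docstring (MMS shell bound `sum_box_three_twoPointFree_le_axis` + Theorem 1.3 at `β_c`,
`dcp_criticalTwoPoint_axis_lower_holds`). [cite: DuminilCopinPanis2025LowerBounds, Theorem 1.3 with the proof of Theorem 1.5 (arXiv:2404.05700 pp. 5–6)] -/
theorem twoPointFree_criticalBeta_axis_frequently_ge :
    ∃ a : ℝ, 0 < a ∧ ∃ᶠ n : ℕ in atTop,
      a ≤ (n : ℝ) ^ (3 / 2 : ℝ) *
        twoPointFree 3 (criticalBeta 3) (Pi.single (⟨0, by norm_num⟩ : Fin 3) (n : ℤ)) := by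
  classical
  -- Theorem 1.3 at `β_c`, `d = 3`
  obtain ⟨c₁, hc₁, N₁, -, hmain⟩ := dcp_criticalTwoPoint_axis_lower_holds (d := 3) (le_refl 3)
  set β : ℝ := criticalBeta 3 with hβdef
  have hβ : 0 ≤ β := criticalBeta_nonneg 3
  -- the axial profile
  set G : ℕ → ℝ := fun k => twoPointFree 3 β (Pi.single (⟨0, by norm_num⟩ : Fin 3) (k : ℤ)) with hGdef
  have hG0 : ∀ k, 0 ≤ G k := fun k => twoPointFree_nonneg_of_nonneg hβ _
  have hG1 : ∀ k, G k ≤ 1 := by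
    intro k
    have h := twoPointFree_le_single_of_le hβ (by norm_num : 1 ≤ 3)
      (y := Pi.single (⟨0, by norm_num⟩ : Fin 3) (k : ℤ)) (s := 0) (Nat.zero_le _)
    simpa only [hGdef, Nat.cast_zero, Pi.single_zero, twoPointFree_zero] using h
  -- the constant `Z = Σ_k k^{-3/2}`
  have hZs : Summable (fun k : ℕ => (k : ℝ) ^ (-(3 / 2 : ℝ))) :=
    Real.summable_nat_rpow.2 (by norm_num)
  set Z : ℝ := ∑' k : ℕ, (k : ℝ) ^ (-(3 / 2 : ℝ)) with hZdef
  have hZ0 : 0 ≤ Z := tsum_nonneg fun k => Real.rpow_nonneg (Nat.cast_nonneg k) _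
  -- the candidate `a`
  set a : ℝ := min 1 (c₁ / 870) with hadef
  have ha0 : 0 < a := lt_min one_pos (by positivity)
  have ha1 : a ≤ 1 := min_le_left _ _
  have ha2 : 435 * a ^ 2 ≤ c₁ / 2 := by
    have h1 : a ≤ c₁ / 870 := min_le_right _ _
    have h2 : a ^ 2 ≤ a * (c₁ / 870) := by
      rw [sq]
      exact mul_le_mul_of_nonneg_left h1 ha0.le
    nlinarith [h2, ha1, hc₁]
  refine ⟨a, ha0, ?_⟩
  by_contra hnot
  rw [Filter.not_frequently, Filter.eventually_atTop] at hnot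
  obtain ⟨m₀, hm₀⟩ := hnot
  -- beyond `m₁ := max m₀ 1` the profile is `< a n^{-3/2}`
  set m₁ : ℕ := max m₀ 1 with hm₁def
  have hm₁1 : 1 ≤ m₁ := le_max_right _ _
  have hsmall : ∀ k : ℕ, m₁ ≤ k → (k : ℝ) ^ (3 / 2 : ℝ) * G k < a := fun k hk =>
    not_le.1 (hm₀ k ((le_max_left _ _).trans hk))
  set M : ℝ := (m₁ : ℝ) ^ (5 / 2 : ℝ) with hMdef
  have hM0 : 0 ≤ M := Real.rpow_nonneg (Nat.cast_nonneg _) _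
  -- pointwise majorant of the normalised profile: `k^{3/2} G k ≤ a + M k^{-1}` for `k ≥ 1`
  have hmaj : ∀ k : ℕ, 1 ≤ k →
      (k : ℝ) ^ (3 / 2 : ℝ) * G k ≤ a + M * (k : ℝ) ^ (-(1 : ℝ)) := by
    intro k hk
    have hkpos : (0 : ℝ) < k := by exact_mod_cast hk
    by_cases hkm : m₁ ≤ k
    · have := hsmall k hkm
      have : 0 ≤ M * (k : ℝ) ^ (-(1 : ℝ)) := mul_nonneg hM0 (Real.rpow_nonneg hkpos.le _)
      linarith
    · push Not at hkm
      -- `k < m₁`: `k^{3/2} G k ≤ k^{3/2} ≤ m₁^{5/2} k^{-1}`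
      have hkle : (k : ℝ) ≤ m₁ := by exact_mod_cast hkm.le
      have h1 : (k : ℝ) ^ (3 / 2 : ℝ) * G k ≤ (k : ℝ) ^ (3 / 2 : ℝ) :=
        mul_le_of_le_one_right (Real.rpow_nonneg hkpos.le _) (hG1 k)
      have h2 : (k : ℝ) ^ (3 / 2 : ℝ) = (k : ℝ) ^ (5 / 2 : ℝ) * (k : ℝ) ^ (-(1 : ℝ)) := by
        rw [← Real.rpow_add hkpos]; norm_num
      have h3 : (k : ℝ) ^ (5 / 2 : ℝ) ≤ M :=
        Real.rpow_le_rpow hkpos.le hkle (by norm_num)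
      have h4 : (k : ℝ) ^ (5 / 2 : ℝ) * (k : ℝ) ^ (-(1 : ℝ)) ≤ M * (k : ℝ) ^ (-(1 : ℝ)) :=
        mul_le_mul_of_nonneg_right h3 (Real.rpow_nonneg hkpos.le _)
      linarith [h1, h2 ▸ h4, ha0.le]
  -- consequences: `k² G k ≤ a k^{1/2} + M k^{-1/2}` and `k G k ≤ a k^{-1/2} + M k^{-3/2}`
  have hbox_term : ∀ k : ℕ, 1 ≤ k →
      54 * (k : ℝ) ^ 2 * G k ≤
        54 * a * (k : ℝ) ^ (1 / 2 : ℝ) + 54 * M * (k : ℝ) ^ (-(1 / 2 : ℝ)) := by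
    intro k hk
    have hkpos : (0 : ℝ) < k := by exact_mod_cast hk
    have h := hmaj k hk
    have hsq : (k : ℝ) ^ 2 = (k : ℝ) ^ (1 / 2 : ℝ) * (k : ℝ) ^ (3 / 2 : ℝ) := by
      rw [← Real.rpow_add hkpos, ← Real.rpow_natCast]; norm_num
    have hk12 : 0 ≤ (k : ℝ) ^ (1 / 2 : ℝ) := Real.rpow_nonneg hkpos.le _
    have hprod : (k : ℝ) ^ (1 / 2 : ℝ) * ((k : ℝ) ^ (3 / 2 : ℝ) * G k) ≤
        (k : ℝ) ^ (1 / 2 : ℝ) * (a + M * (k : ℝ) ^ (-(1 : ℝ))) :=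
      mul_le_mul_of_nonneg_left h hk12
    have hcomb : (k : ℝ) ^ (1 / 2 : ℝ) * (k : ℝ) ^ (-(1 : ℝ)) = (k : ℝ) ^ (-(1 / 2 : ℝ)) := by
      rw [← Real.rpow_add hkpos]; norm_num
    calc 54 * (k : ℝ) ^ 2 * G k
        = 54 * ((k : ℝ) ^ (1 / 2 : ℝ) * ((k : ℝ) ^ (3 / 2 : ℝ) * G k)) := by rw [hsq]; ring
      _ ≤ 54 * ((k : ℝ) ^ (1 / 2 : ℝ) * (a + M * (k : ℝ) ^ (-(1 : ℝ)))) :=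
          mul_le_mul_of_nonneg_left hprod (by norm_num)
      _ = 54 * a * (k : ℝ) ^ (1 / 2 : ℝ) + 54 * M * (k : ℝ) ^ (-(1 / 2 : ℝ)) := by
          rw [← hcomb]; ring
  have haxis_term : ∀ k : ℕ, 1 ≤ k →
      (k : ℝ) * G k ≤ a * (k : ℝ) ^ (-(1 / 2 : ℝ)) + M * (k : ℝ) ^ (-(3 / 2 : ℝ)) := by
    intro k hk
    have hkpos : (0 : ℝ) < k := by exact_mod_cast hk
    have h := hmaj k hk
    have hone : (k : ℝ) = (k : ℝ) ^ (-(1 / 2 : ℝ)) * (k : ℝ) ^ (3 / 2 : ℝ) := by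
      rw [← Real.rpow_add hkpos]; norm_num
    have hkm12 : 0 ≤ (k : ℝ) ^ (-(1 / 2 : ℝ)) := Real.rpow_nonneg hkpos.le _
    have hprod : (k : ℝ) ^ (-(1 / 2 : ℝ)) * ((k : ℝ) ^ (3 / 2 : ℝ) * G k) ≤
        (k : ℝ) ^ (-(1 / 2 : ℝ)) * (a + M * (k : ℝ) ^ (-(1 : ℝ))) :=
      mul_le_mul_of_nonneg_left h hkm12
    have hcomb : (k : ℝ) ^ (-(1 / 2 : ℝ)) * (k : ℝ) ^ (-(1 : ℝ)) = (k : ℝ) ^ (-(3 / 2 : ℝ)) := by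
      rw [← Real.rpow_add hkpos]; norm_num
    calc (k : ℝ) * G k = (k : ℝ) ^ (-(1 / 2 : ℝ)) * ((k : ℝ) ^ (3 / 2 : ℝ) * G k) := by
          conv_lhs => rw [hone]
          ring
      _ ≤ (k : ℝ) ^ (-(1 / 2 : ℝ)) * (a + M * (k : ℝ) ^ (-(1 : ℝ))) := hprod
      _ = a * (k : ℝ) ^ (-(1 / 2 : ℝ)) + M * (k : ℝ) ^ (-(3 / 2 : ℝ)) := by
          rw [← hcomb]; ring
  -- bound on the box susceptibility `χ_{4n}`
  have hchi : ∀ n : ℕ, 1 ≤ n →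
      ∑ x ∈ box 3 (4 * n), twoPointFree 3 β x ≤
        1 + 216 * M * (n : ℝ) ^ (1 / 2 : ℝ) + 432 * a * (n : ℝ) ^ (3 / 2 : ℝ) := by
    intro n hn
    have hnpos : (0 : ℝ) < n := by exact_mod_cast hn
    have h1 := sum_box_three_twoPointFree_le_axis hβ (4 * n)
    have h2 : ∑ m ∈ Finset.Icc 1 (4 * n), 54 * (m : ℝ) ^ 2 * G m ≤
        ∑ m ∈ Finset.Icc 1 (4 * n),
          (54 * a * (m : ℝ) ^ (1 / 2 : ℝ) + 54 * M * (m : ℝ) ^ (-(1 / 2 : ℝ))) :=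
      Finset.sum_le_sum fun m hm => hbox_term m (Finset.mem_Icc.1 hm).1
    rw [Finset.sum_add_distrib, ← Finset.mul_sum, ← Finset.mul_sum] at h2
    -- `Σ_{m ≤ 4n} m^{1/2} ≤ 4n (4n)^{1/2} = 8 n^{3/2}`
    have h3 : ∑ m ∈ Finset.Icc 1 (4 * n), (m : ℝ) ^ (1 / 2 : ℝ) ≤ 8 * (n : ℝ) ^ (3 / 2 : ℝ) := by
      have hle : ∀ m ∈ Finset.Icc 1 (4 * n), (m : ℝ) ^ (1 / 2 : ℝ) ≤ ((4 * n : ℕ) : ℝ) ^ (1 / 2 : ℝ) :=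
        fun m hm => Real.rpow_le_rpow (Nat.cast_nonneg m)
          (by exact_mod_cast (Finset.mem_Icc.1 hm).2) (by norm_num)
      calc ∑ m ∈ Finset.Icc 1 (4 * n), (m : ℝ) ^ (1 / 2 : ℝ)
          ≤ ∑ _m ∈ Finset.Icc 1 (4 * n), ((4 * n : ℕ) : ℝ) ^ (1 / 2 : ℝ) := Finset.sum_le_sum hle
        _ = (4 * n : ℕ) * ((4 * n : ℕ) : ℝ) ^ (1 / 2 : ℝ) := by
            rw [Finset.sum_const, Nat.card_Icc, nsmul_eq_mul]
            norm_num
        _ = 8 * (n : ℝ) ^ (3 / 2 : ℝ) := by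
            push_cast
            rw [Real.mul_rpow (by norm_num) hnpos.le,
              show (4 : ℝ) ^ (1 / 2 : ℝ) = 2 by
                rw [show (4 : ℝ) = 2 ^ (2 : ℝ) by norm_num, ← Real.rpow_mul (by norm_num)]
                norm_num,
              show (n : ℝ) ^ (3 / 2 : ℝ) = n * (n : ℝ) ^ (1 / 2 : ℝ) by
                rw [show (3 / 2 : ℝ) = 1 + 1 / 2 by norm_num, Real.rpow_add hnpos, Real.rpow_one]]
            ring
    -- `Σ_{m ≤ 4n} m^{-1/2} ≤ 2 (4n)^{1/2} = 4 n^{1/2}`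
    have h4 : ∑ m ∈ Finset.Icc 1 (4 * n), (m : ℝ) ^ (-(1 / 2 : ℝ)) ≤ 4 * (n : ℝ) ^ (1 / 2 : ℝ) := by
      have h := sum_Icc_rpow_neg_half_le (4 * n)
      calc ∑ m ∈ Finset.Icc 1 (4 * n), (m : ℝ) ^ (-(1 / 2 : ℝ)) ≤ 2 * ((4 * n : ℕ) : ℝ) ^ (1 / 2 : ℝ) := h
        _ = 4 * (n : ℝ) ^ (1 / 2 : ℝ) := by
            push_cast
            rw [Real.mul_rpow (by norm_num) hnpos.le,
              show (4 : ℝ) ^ (1 / 2 : ℝ) = 2 by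
                rw [show (4 : ℝ) = 2 ^ (2 : ℝ) by norm_num, ← Real.rpow_mul (by norm_num)]
                norm_num]
            ring
    have h5 : 54 * a * ∑ m ∈ Finset.Icc 1 (4 * n), (m : ℝ) ^ (1 / 2 : ℝ) ≤
        54 * a * (8 * (n : ℝ) ^ (3 / 2 : ℝ)) := mul_le_mul_of_nonneg_left h3 (by positivity)
    have h6 : 54 * M * ∑ m ∈ Finset.Icc 1 (4 * n), (m : ℝ) ^ (-(1 / 2 : ℝ)) ≤
        54 * M * (4 * (n : ℝ) ^ (1 / 2 : ℝ)) := mul_le_mul_of_nonneg_left h4 (by positivity)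
    linarith [h1, h2, h5, h6]
  -- bound on the axial sum `n Σ_{k ≤ 2n} k G k`
  have haxis : ∀ n : ℕ, 1 ≤ n →
      (n : ℝ) * ∑ k ∈ Finset.Icc 1 (2 * n), (k : ℝ) * G k ≤
        M * Z * n + 3 * a * (n : ℝ) ^ (3 / 2 : ℝ) := by
    intro n hn
    have hnpos : (0 : ℝ) < n := by exact_mod_cast hn
    have h2 : ∑ k ∈ Finset.Icc 1 (2 * n), (k : ℝ) * G k ≤
        ∑ k ∈ Finset.Icc 1 (2 * n),
          (a * (k : ℝ) ^ (-(1 / 2 : ℝ)) + M * (k : ℝ) ^ (-(3 / 2 : ℝ))) :=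
      Finset.sum_le_sum fun k hk => haxis_term k (Finset.mem_Icc.1 hk).1
    rw [Finset.sum_add_distrib, ← Finset.mul_sum, ← Finset.mul_sum] at h2
    -- `Σ_{k ≤ 2n} k^{-1/2} ≤ 2 (2n)^{1/2} ≤ 3 n^{1/2}`
    have h3 : ∑ k ∈ Finset.Icc 1 (2 * n), (k : ℝ) ^ (-(1 / 2 : ℝ)) ≤ 3 * (n : ℝ) ^ (1 / 2 : ℝ) := by
      have h := sum_Icc_rpow_neg_half_le (2 * n)
      have hsqrt2 : (2 : ℝ) ^ (1 / 2 : ℝ) ≤ 3 / 2 := by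
        have h9 : ((2 : ℝ) ^ (1 / 2 : ℝ)) ^ (2 : ℕ) = 2 := by
          rw [← Real.rpow_natCast, ← Real.rpow_mul (by norm_num)]; norm_num
        nlinarith [h9, Real.rpow_nonneg (show (0 : ℝ) ≤ 2 by norm_num) (1 / 2 : ℝ)]
      have hn12 : 0 ≤ (n : ℝ) ^ (1 / 2 : ℝ) := Real.rpow_nonneg hnpos.le _
      calc ∑ k ∈ Finset.Icc 1 (2 * n), (k : ℝ) ^ (-(1 / 2 : ℝ)) ≤ 2 * ((2 * n : ℕ) : ℝ) ^ (1 / 2 : ℝ) := h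
        _ = 2 * (2 : ℝ) ^ (1 / 2 : ℝ) * (n : ℝ) ^ (1 / 2 : ℝ) := by
            push_cast
            rw [Real.mul_rpow (by norm_num) hnpos.le]
            ring
        _ ≤ 2 * (3 / 2) * (n : ℝ) ^ (1 / 2 : ℝ) := by gcongr
        _ = 3 * (n : ℝ) ^ (1 / 2 : ℝ) := by ring
    -- `Σ_{k ≤ 2n} k^{-3/2} ≤ Z`
    have h4 : ∑ k ∈ Finset.Icc 1 (2 * n), (k : ℝ) ^ (-(3 / 2 : ℝ)) ≤ Z :=
      hZs.sum_le_tsum _ fun k _ => Real.rpow_nonneg (Nat.cast_nonneg k) _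
    have h5 : a * ∑ k ∈ Finset.Icc 1 (2 * n), (k : ℝ) ^ (-(1 / 2 : ℝ)) ≤ a * (3 * (n : ℝ) ^ (1 / 2 : ℝ)) :=
      mul_le_mul_of_nonneg_left h3 ha0.le
    have h6 : M * ∑ k ∈ Finset.Icc 1 (2 * n), (k : ℝ) ^ (-(3 / 2 : ℝ)) ≤ M * Z :=
      mul_le_mul_of_nonneg_left h4 hM0
    have h7 : ∑ k ∈ Finset.Icc 1 (2 * n), (k : ℝ) * G k ≤ a * (3 * (n : ℝ) ^ (1 / 2 : ℝ)) + M * Z := by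
      linarith [h2, h5, h6]
    have h8 : (n : ℝ) * ∑ k ∈ Finset.Icc 1 (2 * n), (k : ℝ) * G k ≤
        (n : ℝ) * (a * (3 * (n : ℝ) ^ (1 / 2 : ℝ)) + M * Z) := mul_le_mul_of_nonneg_left h7 hnpos.le
    have h9 : (n : ℝ) ^ (3 / 2 : ℝ) = n * (n : ℝ) ^ (1 / 2 : ℝ) := by
      rw [show (3 / 2 : ℝ) = 1 + 1 / 2 by norm_num, Real.rpow_add hnpos, Real.rpow_one]
    rw [h9]
    linarith [h8]
  -- the vanishing part: `a n^{-3/2} (1 + 216 M n^{1/2} + M Z n) → 0`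
  have hlim : Tendsto (fun n : ℕ =>
      (n : ℝ) ^ (-(3 / 2 : ℝ)) + 216 * M * (n : ℝ) ^ (-(1 : ℝ)) + M * Z * (n : ℝ) ^ (-(1 / 2 : ℝ)))
      atTop (𝓝 0) := by
    have hp : ∀ p : ℝ, 0 < p → Tendsto (fun n : ℕ => (n : ℝ) ^ (-p)) atTop (𝓝 0) := fun p hp =>
      (tendsto_rpow_neg_atTop hp).comp tendsto_natCast_atTop_atTop
    have h1 := hp (3 / 2) (by norm_num)
    have h2 := (hp 1 one_pos).const_mul (216 * M)
    have h3 := (hp (1 / 2) (by norm_num)).const_mul (M * Z)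
    simpa only [mul_zero, add_zero] using (h1.add h2).add h3
  obtain ⟨n, hnlt, hnge⟩ :=
    ((hlim.eventually (gt_mem_nhds (half_pos hc₁))).and (eventually_ge_atTop (max N₁ m₁))).exists
  have hnN : N₁ ≤ n := le_of_max_le_left hnge
  have hnm : m₁ ≤ n := le_of_max_le_right hnge
  have hn1 : 1 ≤ n := hm₁1.trans hnm
  have hnpos : (0 : ℝ) < n := by exact_mod_cast hn1
  -- Theorem 1.3 at this `n`
  have h13 := hmain n hnN
  simp only [show (3 : ℕ) - 2 = 1 from rfl, pow_one] at h13
  -- the denominator and its bound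
  set D : ℝ := (∑ x ∈ box 3 (4 * n), twoPointFree 3 β x) +
      (n : ℝ) * ∑ k ∈ Finset.Icc 1 (2 * n), (k : ℝ) * G k with hDdef
  have hDpos : 0 < D :=
    dcp_denominator_pos (twoPointFree_zero 3 β) (fun x => twoPointFree_nonneg_of_nonneg hβ x) _ n
  have hDle : D ≤ 1 + 216 * M * (n : ℝ) ^ (1 / 2 : ℝ) + M * Z * n + 435 * a * (n : ℝ) ^ (3 / 2 : ℝ) := by
    have := hchi n hn1
    have := haxis n hn1
    linarith
  -- from Theorem 1.3: `c₁ ≤ G n · D`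
  have hc1le : c₁ ≤ G n * D := by
    have h : c₁ / D ≤ G n := h13
    rwa [div_le_iff₀ hDpos] at h
  -- from the smallness: `G n < a n^{-3/2}`
  have hGn : (n : ℝ) ^ (3 / 2 : ℝ) * G n < a := hsmall n hnm
  have hn32 : 0 < (n : ℝ) ^ (3 / 2 : ℝ) := Real.rpow_pos_of_pos hnpos _
  -- combine: `c₁ n^{3/2} ≤ n^{3/2} G n D < a D`
  have hkey : c₁ * (n : ℝ) ^ (3 / 2 : ℝ) < a * D := by
    calc c₁ * (n : ℝ) ^ (3 / 2 : ℝ) ≤ G n * D * (n : ℝ) ^ (3 / 2 : ℝ) :=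
          mul_le_mul_of_nonneg_right hc1le hn32.le
      _ = ((n : ℝ) ^ (3 / 2 : ℝ) * G n) * D := by ring
      _ < a * D := mul_lt_mul_of_pos_right hGn hDpos
  -- `a D ≤ a (1 + 216 M n^{1/2} + M Z n) + 435 a² n^{3/2}` and `a ≤ 1`
  have hsmallpart : (n : ℝ) ^ (-(3 / 2 : ℝ)) + 216 * M * (n : ℝ) ^ (-(1 : ℝ)) +
      M * Z * (n : ℝ) ^ (-(1 / 2 : ℝ)) < c₁ / 2 := hnlt
  -- multiply the small part by `n^{3/2}`
  have hresc : ((n : ℝ) ^ (-(3 / 2 : ℝ)) + 216 * M * (n : ℝ) ^ (-(1 : ℝ)) +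
      M * Z * (n : ℝ) ^ (-(1 / 2 : ℝ))) * (n : ℝ) ^ (3 / 2 : ℝ) =
      1 + 216 * M * (n : ℝ) ^ (1 / 2 : ℝ) + M * Z * n := by
    have e1 : (n : ℝ) ^ (-(3 / 2 : ℝ)) * (n : ℝ) ^ (3 / 2 : ℝ) = 1 := by
      rw [← Real.rpow_add hnpos]; norm_num
    have e2 : (n : ℝ) ^ (-(1 : ℝ)) * (n : ℝ) ^ (3 / 2 : ℝ) = (n : ℝ) ^ (1 / 2 : ℝ) := by
      rw [← Real.rpow_add hnpos]; norm_num
    have e3 : (n : ℝ) ^ (-(1 / 2 : ℝ)) * (n : ℝ) ^ (3 / 2 : ℝ) = n := by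
      rw [← Real.rpow_add hnpos]; norm_num
    calc ((n : ℝ) ^ (-(3 / 2 : ℝ)) + 216 * M * (n : ℝ) ^ (-(1 : ℝ)) +
          M * Z * (n : ℝ) ^ (-(1 / 2 : ℝ))) * (n : ℝ) ^ (3 / 2 : ℝ)
        = (n : ℝ) ^ (-(3 / 2 : ℝ)) * (n : ℝ) ^ (3 / 2 : ℝ) +
            216 * M * ((n : ℝ) ^ (-(1 : ℝ)) * (n : ℝ) ^ (3 / 2 : ℝ)) +
            M * Z * ((n : ℝ) ^ (-(1 / 2 : ℝ)) * (n : ℝ) ^ (3 / 2 : ℝ)) := by ring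
      _ = 1 + 216 * M * (n : ℝ) ^ (1 / 2 : ℝ) + M * Z * n := by rw [e1, e2, e3]
  have hbnd1 : 1 + 216 * M * (n : ℝ) ^ (1 / 2 : ℝ) + M * Z * n < c₁ / 2 * (n : ℝ) ^ (3 / 2 : ℝ) := by
    rw [← hresc]
    exact mul_lt_mul_of_pos_right hsmallpart hn32
  have hpos1 : 0 ≤ 1 + 216 * M * (n : ℝ) ^ (1 / 2 : ℝ) + M * Z * n := by
    have : 0 ≤ (n : ℝ) ^ (1 / 2 : ℝ) := Real.rpow_nonneg hnpos.le _
    positivity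
  have hfinal : a * D ≤ c₁ / 2 * (n : ℝ) ^ (3 / 2 : ℝ) + c₁ / 2 * (n : ℝ) ^ (3 / 2 : ℝ) := by
    calc a * D ≤ a * (1 + 216 * M * (n : ℝ) ^ (1 / 2 : ℝ) + M * Z * n + 435 * a * (n : ℝ) ^ (3 / 2 : ℝ)) :=
          mul_le_mul_of_nonneg_left hDle ha0.le
      _ = a * (1 + 216 * M * (n : ℝ) ^ (1 / 2 : ℝ) + M * Z * n) + 435 * a ^ 2 * (n : ℝ) ^ (3 / 2 : ℝ) := by
          ring
      _ ≤ 1 * (1 + 216 * M * (n : ℝ) ^ (1 / 2 : ℝ) + M * Z * n) + c₁ / 2 * (n : ℝ) ^ (3 / 2 : ℝ) := by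
          gcongr
      _ ≤ c₁ / 2 * (n : ℝ) ^ (3 / 2 : ℝ) + c₁ / 2 * (n : ℝ) ^ (3 / 2 : ℝ) := by
          rw [one_mul]
          exact add_le_add hbnd1.le le_rfl
  have : c₁ * (n : ℝ) ^ (3 / 2 : ℝ) < c₁ * (n : ℝ) ^ (3 / 2 : ℝ) := by
    calc c₁ * (n : ℝ) ^ (3 / 2 : ℝ) < a * D := hkey
      _ ≤ c₁ / 2 * (n : ℝ) ^ (3 / 2 : ℝ) + c₁ / 2 * (n : ℝ) ^ (3 / 2 : ℝ) := hfinal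
      _ = c₁ * (n : ℝ) ^ (3 / 2 : ℝ) := by ring
  exact lt_irrefl _ this

/-- **The critical axial two-point function of `ℤ³` is not `o(n^{-3/2})` (plus state = the tree's
`criticalTwoPoint 3`).** Same statement for `⟨σ₀σ_{ne₁}⟩⁺_{β_c}` (`μ⁺_{β_c} = μ^f_{β_c}` on pairs for
`d ≥ 3`, `twoPointPlus_criticalBeta_eq_twoPointFree_holds`): `∃ a > 0`, `a ≤ n^{3/2}⟨σ₀σ_{ne₁}⟩_{β_c}` for
infinitely many `n` — "`η ≤ 1/2` along a subsequence", unconditionally. [cite: DuminilCopinPanis2025LowerBounds, Theorem 1.3 with the proof of Theorem 1.5 (arXiv:2404.05700 pp. 5–6)] -/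
theorem criticalTwoPoint_axis_frequently_ge :
    ∃ a : ℝ, 0 < a ∧ ∃ᶠ n : ℕ in atTop,
      a ≤ (n : ℝ) ^ (3 / 2 : ℝ) * criticalTwoPoint 3 (Pi.single (⟨0, by norm_num⟩ : Fin 3) (n : ℤ)) := by
  obtain ⟨a, ha, h⟩ := twoPointFree_criticalBeta_axis_frequently_ge
  refine ⟨a, ha, h.mono fun n hn => ?_⟩
  unfold criticalTwoPoint
  rwa [twoPointPlus_criticalBeta_eq_twoPointFree_holds (d := 3) (by norm_num)]

end Literature.Probability.LatticeModels

end
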